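import Summits.HodgeConjecture.HodgeConjecture.Theorems.MarkmanPartnerTransportPicardThreeK3SquaresQuadraticLemmas
import Summits.HodgeConjecture.HodgeConjecture.Theorems.MarkmanPartnerTransportLowPicardRMGenerator
import Literature.AlgebraicGeometry.Surfaces.K3RealMultiplicationExistence

/-!
# Route MarkmanPartnerTransport · crux `PicardThreeK3Squares` (stmt-HodgeConjecture-19652) —
# «RM-GEN-K3»: a non-CM, non-scalar projective K3 surface IS a real-multiplication K3 surface of a
# definite TYPE `(ρ, d, m)` in van Geemen–Schütt's vocabulary

K3-side twin of `PartnerLattice.exists_rmGenerator_of_not_spannedByIsometries` («RM-GEN» for marked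
`K3^{[2]}`-type fourfolds, `…LowPicardRMCells`). For a projective K3 surface `S` (granted markings) whose
transcendental Hodge endomorphisms are neither all rational scalars (`¬ Scalar`) nor of CM type
(`¬ HasComplexMultiplication S`), `E = End_Hdg(T(S)_ℚ)` is a totally real field (Zarhin; a non-real character
value is the CM witness `hasComplexMultiplication_of_conj_ne`) of degree `d ≥ 2`, and a PRIMITIVE ELEMENT `r₀`
(`PartnerLattice.exists_generator_endAlg`), extended by ZERO on `N_ℚ` and conjugated by the marking, is a
rational, type-preserving endomorphism `t` of `H²(S(ℂ); ℂ)` KILLING `N¹(S)`, with image cup-orthogonal to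
`N¹(S)`, annihilated on `T(S)` by the IRREDUCIBLE `P = minpoly_ℚ(r₀)` (`deg P = d`) and GENERATING (power basis of
`E/ℚ`). With van Geemen's `dim_ℚ T(S) = d · m`, `m ≥ 3`, and the count `dim_ℚ T(S) = 22 − ρ(S)`:

* `exists_isRealMultiplicationK3_of_not_hasComplexMultiplication` — `∃ P m, Irreducible P ∧ 2 ≤ deg P ∧ 3 ≤ m ∧
  deg P · m + ρ(S) = 22 ∧ IsRealMultiplicationK3 S ρ(S) P`: LITERALLY the Literature predicate of
  `Surfaces/K3RealMultiplicationExistence` (van Geemen–Schütt 2025 §2.1, "RM by `F`": `F = End_Hdg(T_{X,ℚ})`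
  totally real `≠ ℚ`, rendered through a primitive element), so far only POSTULATED for the printed families.

Sequel `…RealMultiplicationTypeCorollaries`: the TYPE of the NL-ascent (`Terminal[S]`, `Quadratic[S]`) becomes
intrinsic. No definition, no sorry, no named fact beyond the displayed `Huybrechts_K3_marking_exists`;
`--supports stmt-HodgeConjecture-19652` (prover seat hodge-nonav-19652-p1, gen 19). Nothing here proves the crux
or any instance of HC.

References: Yu. G. Zarhin, J. reine angew. Math. 341 (1983) Thm. 1.5.1, 1.6; B. van Geemen, Michigan Math. J. 56
(2008) Lemma 3.2; B. van Geemen, M. Schütt, Forum Math. Sigma 13 (2025) e2, §2.1, §2.4; D. Huybrechts, *Lectures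
on K3 Surfaces*, Ch. 3 Lemma 3.3.1, Cor. 3.3.6, Thm. 3.3.7.
-/

set_option linter.dupNamespace false

noncomputable section

namespace Summit.HodgeConjecture.HodgeConjecture.Theorems.MarkmanPartnerTransport.RealMultiplicationType

open scoped Manifold TensorProduct
open Module CategoryTheory MonoidalCategory CartesianMonoidalCategory Polynomial
open Literature.AlgebraicGeometry Literature.AlgebraicGeometry.Motives Literature.AlgebraicGeometry.HodgeTheory
open Literature.AlgebraicGeometry.Motives.HodgeStructure
open Literature.AlgebraicGeometry.Surfaces
open Literature.AlgebraicTopology.SingularHomology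
open Summit.HodgeConjecture.HodgeConjecture.Theorems
open Summit.HodgeConjecture.HodgeConjecture.Theorems.NikulinTwinTransport
open Summit.HodgeConjecture.HodgeConjecture.Theorems.AnchorExistenceCMFloor
open Summit.HodgeConjecture.HodgeConjecture.Theorems.MarkmanPartnerTransport.RealMultiplicationRanks
open Summit.HodgeConjecture.HodgeConjecture.Theorems.MarkmanPartnerTransport.KugaSatakeSimilitude
  (finrank_ratPoints_eq hasComplexMultiplication_of_conj_ne)
open Summit.HodgeConjecture.HodgeConjecture.Theorems.MarkmanPartnerTransport.PartnerLattice
  (exists_generator_endAlg)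

section Abstract

variable {V : Type*} [AddCommGroup V] [Module ℚ V] [Module.Finite ℚ V] {H : HodgeStructure V 2}

/-- In the endomorphism FIELD `E = End_Hdg(V)` (Zarhin), read in `ℂ` through an injective character `ε`,
the minimal polynomial `P = minpoly_ℚ(ε r) = minpoly_ℚ(r)` of any `r ∈ E` is IRREDUCIBLE and `P(r) = 0` — spelled
on the carrier `V` as `Σᵢ Pᵢ rⁱ = 0` in `End_ℚ(V)`. [cite: Zarhin1983HodgeGroupsK3, Thm. 1.6]
[cite: Huybrechts2016K3, Ch. 3 Cor. 3.3.6] -/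
theorem irreducible_minpoly_and_sum_coeff_smul_pow_eq_zero (hF : IsField H.endAlg) (ε : H.endAlg →ₐ[ℚ] ℂ)
    (hε : Function.Injective ε) (r : H.endAlg) :
    Irreducible (minpoly ℚ (ε r)) ∧
      (∑ i ∈ Finset.range ((minpoly ℚ (ε r)).natDegree + 1),
        (minpoly ℚ (ε r)).coeff i • (r : Module.End ℚ V) ^ i) = 0 := by
  haveI : Module.Finite ℚ H.endAlg := finiteDimensional_endAlg H
  haveI := OneCycle.isDomain_endAlg_of_isField hF
  rw [minpoly.algHom_eq ε hε]
  refine ⟨minpoly.irreducible (.of_finite ℚ r), ?_⟩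
  have h0 := minpoly.aeval ℚ r
  rw [Polynomial.aeval_eq_sum_range] at h0
  have h1 := congrArg (fun e : H.endAlg => (e : Module.End ℚ V)) h0
  simpa only [AddSubmonoidClass.coe_finsetSum, Subalgebra.coe_smul, Subalgebra.coe_pow, Subalgebra.coe_zero]
    using h1

end Abstract

variable {S : SchemeOver ℂ}

/-- `Transc[S, y]`: `y` is cup-orthogonal to `N¹(S)`. Local notation only. -/
local notation3 (prettyPrint := false) "Transc[" S ", " y "]" =>
  (∀ d ∈ algebraicClasses S 1, cupProduct (rfl : 2 * 1 + 2 * 1 = 2 * 2) y d = 0)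

/-- `Scalar[S]`: «`End_Hdg(T(S)) = ℚ`» — VERBATIM the scalar clause of
`RealMultiplicationRanks.scalar_or_hasComplexMultiplication_of_forall_mul_add_ne` and of `…NLAscent`. Local
notation only. -/
local notation3 (prettyPrint := false) "Scalar[" S "]" =>
  (∀ (f : complexBetti S (2 * 1) →ₗ[ℂ] complexBetti S (2 * 1)),
    (∀ y, IsRationalClass y → IsRationalClass (f y)) →
    (∀ (i j : ℕ) y, IsOfHodgeType 2 S (2 * 1) i j y → IsOfHodgeType 2 S (2 * 1) i j (f y)) →
    (∀ d ∈ algebraicClasses S 1, f d = 0) →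
    (∀ y : complexBetti S (2 * 1), ∀ d ∈ algebraicClasses S 1,
      cupProduct (rfl : 2 * 1 + 2 * 1 = 2 * 2) (f y) d = 0) →
    ∃ a : ℚ, ∀ y : complexBetti S (2 * 1),
      (∀ d ∈ algebraicClasses S 1, cupProduct (rfl : 2 * 1 + 2 * 1 = 2 * 2) y d = 0) →
        f y = (a : ℂ) • y)

/-- **«RM-GEN-K3»: a projective K3 surface that is neither scalar nor CM is a real-multiplication K3 surface
of a definite type.** For a projective K3 surface `S` (granted `Huybrechts_K3_marking_exists`) with
`¬ HasComplexMultiplication S` and `¬ Scalar[S]` there are an IRREDUCIBLE `P ∈ ℚ[X]` and `m ≥ 3` with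
`2 ≤ deg P`, `deg P · m + ρ(S) = 22` and `IsRealMultiplicationK3 S ρ(S) P`: a rational, type-preserving
endomorphism `t` of `H²(S(ℂ); ℂ)` killing `N¹(S)`, with image cup-orthogonal to `N¹(S)`, `P(t) = 0` on `T(S)`,
generating `End_Hdg(T(S))`. Marking picture of `RealMultiplicationRanks.scalar_or_hasComplexMultiplication_of_forall_mul_add_ne`:
`E = End_Hdg(T)` is a field (Zarhin) — totally real (else CM), `≠ ℚ` (else scalar); `t := η⁻¹ ∘ (r₀ ⊕ 0_N)_ℂ ∘ η`
for a primitive element `r₀` (`exists_generator_endAlg`, with `dim_ℚ T = d · m`, van Geemen), `P := minpoly_ℚ(r₀)`;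
`dim_ℚ T = 22 − ρ(S)` (`finrank_ratPoints_eq`). [cite: Zarhin1983HodgeGroupsK3, Thm. 1.5.1 and Thm. 1.6]
[cite: Vangeemen2008, Lemma 3.2] [cite: GeemenSchutt2023, §2.1 and §2.4]
[cite: Huybrechts2016K3, Ch. 3 Lemma 3.3.1 and Thm. 3.3.7] -/
theorem exists_isRealMultiplicationK3_of_not_hasComplexMultiplication (hmark : Huybrechts_K3_marking_exists)
    (hS : IsK3Surface S) (hCM : ¬ HasComplexMultiplication S) (hQ : ¬ Scalar[S]) :
    ∃ (P : ℚ[X]) (m : ℕ), Irreducible P ∧ 2 ≤ P.natDegree ∧ 3 ≤ m ∧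
      P.natDegree * m + Module.finrank ℂ ↥(algebraicClasses S 1) = 22 ∧
      IsRealMultiplicationK3 S (Module.finrank ℂ ↥(algebraicClasses S 1)) P := by
  classical
  -- ### the marking picture (as in `RealMultiplicationRanks.scalar_or_hasComplexMultiplication_of_forall_mul_add_ne`)
  have hHT : Huybrechts_K3_hodgeTypes_H2 := Huybrechts_K3_hodgeTypes_H2_holds
  obtain ⟨η, p₀, x, hp₀, ⟨hp₀int, hp₀gen, hηint, hηcup, hx20, hx20'⟩, hxx, hxpos, hu⟩ := hmark S hS
  set N := algebraicClasses S 1 with hNdef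
  set σ := η.symm x with hσdef
  have hησ : η σ = x := by rw [hσdef, LinearEquiv.apply_symm_apply]
  have hxne : σ ≠ 0 := by
    intro h0
    have hx : x = 0 := by rw [← hησ, h0, map_zero]
    subst hx; simp [k3Form] at hxpos
  obtain ⟨h₁, -, h₃⟩ := hHT S hS σ hx20 hxne
  have hσbar : conjClass (ComplexPoints S) (2 * 1) σ = η.symm (star x) := conjClass_marking_symm η hηint x
  have hsmul0 : ∀ {c : ℂ}, c • p₀ = 0 → c = 0 := fun h => by
    rcases smul_eq_zero.1 h with h | h
    · exact h
    · exact absurd h hp₀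
  have hL11 : ∀ c : complexBetti S (2 * 1), IsRationalClass c → IsOfHodgeType 2 S (2 * 1) 1 1 c → c ∈ N :=
    fun c hc h11 => lefschetzOneOne_rational_holds hS.1 c hc h11
  have hND : ∀ c ∈ N, IsRationalClass c → Transc[S, c] → c = 0 :=
    fun c hcN hc hperp => anchorExistence_cmFloor_divisorClass_eq_zero_of_hodgeIndex
      hodgeIndex_surface_holds lefschetzOneOne_rational_holds
      Grothendieck1969_supportedClasses_le_hodgeConiveau_holds hS hcN hc hperp
  have hrat : ∀ c, IsRationalClass c ↔ ∃ w : K3Index → ℚ, η c = fun i => (w i : ℂ) :=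
    isRationalClass_iff_of_marking hS η hηint
  -- the rational points of `N`
  let NQ : Submodule ℚ (K3Index → ℚ) :=
    { carrier := {u | η.symm (fun j => (u j : ℂ)) ∈ N}
      add_mem' := fun {u v} hu hv => by
        simp only [Set.mem_setOf_eq, ratCastΛ_add, map_add]; exact N.add_mem hu hv
      zero_mem' := by simp only [Set.mem_setOf_eq, ratCastΛ_zero, map_zero]; exact N.zero_mem
      smul_mem' := fun q u hu => by
        simp only [Set.mem_setOf_eq, ratCastΛ_smul, map_smul]; exact N.smul_mem _ hu }
  have memNQ : ∀ u, u ∈ NQ ↔ η.symm (fun j => (u j : ℂ)) ∈ N := fun u => Iff.rfl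
  have h11_iff : ∀ v : K3Index → ℂ, IsOfHodgeType 2 S (2 * 1) 1 1 (η.symm v) ↔
      (k3Form v x = 0 ∧ k3Form v (star x) = 0) := by
    intro v
    rw [h₃ (η.symm v), hηcup, hηcup, LinearEquiv.apply_symm_apply, hησ, hσbar, LinearEquiv.apply_symm_apply]
    constructor
    · rintro ⟨ha, hb⟩; exact ⟨hsmul0 ha, hsmul0 hb⟩
    · rintro ⟨ha, hb⟩; rw [ha, hb, zero_smul]; exact ⟨rfl, rfl⟩
  have hN : ∀ u : K3Index → ℚ, u ∈ NQ ↔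
      (k3Form (fun i => (u i : ℂ)) x = 0 ∧ k3Form (fun i => (u i : ℂ)) (star x) = 0) := by
    intro u
    rw [memNQ, ← h11_iff]
    exact ⟨fun hu => isOfHodgeType_of_mem_algebraicClasses_of_isSmoothProjective hS.1 1 hu,
      fun hu => hL11 _ ((hrat _).2 ⟨u, LinearEquiv.apply_symm_apply _ _⟩) hu⟩
  have hspan := span_isRationalClass_eq_top_of_isSmoothProjective_holds.supportedClasses_eq_span hS.1 (2 * 1) 1
  have horth : ∀ u ∈ k3FormRat.orthogonal NQ, ∀ d ∈ N, k3Form (fun j => (u j : ℂ)) (η d) = 0 := by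
    intro u hu d hd
    rw [LinearMap.BilinForm.mem_orthogonal_iff] at hu
    have hd' : d ∈ Submodule.span ℂ {c : complexBetti S (2 * 1) |
        IsRationalClass c ∧ c ∈ supportedClasses S (2 * 1) 1} := by rw [← hspan]; exact hd
    clear hd
    induction hd' using Submodule.span_induction with
    | mem d hd =>
      obtain ⟨w, hw⟩ := (hrat d).1 hd.1
      have hwN : w ∈ NQ := by rw [memNQ, ← hw, LinearEquiv.symm_apply_apply]; exact hd.2
      rw [hw, k3Form_ratCast, k3FormRat_isSymm.eq, hu w hwN, Rat.cast_zero]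
    | zero => rw [map_zero, k3Form_zero_right]
    | add c c' _ _ hc hc' => rw [map_add, k3Form_add_right, hc, hc', add_zero]
    | smul t c _ hc => rw [map_smul, k3Form_smul_right, hc, mul_zero]
  have hdisj : Disjoint NQ (k3FormRat.orthogonal NQ) := by
    rw [Submodule.disjoint_def]
    intro u huN huT
    have hc0 : η.symm (fun j => (u j : ℂ)) = 0 :=
      hND _ ((memNQ u).1 huN) ((hrat _).2 ⟨u, LinearEquiv.apply_symm_apply _ _⟩) fun d hd => by
        rw [hηcup, LinearEquiv.apply_symm_apply, horth u huT d hd, zero_smul]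
    apply ratCastΛ_injective
    rw [ratCastΛ_zero]; exact η.symm.injective (hc0.trans (map_zero _).symm)
  have hc := isCompl_orthogonal hdisj
  -- the transcendental Hodge structure; its endomorphism field (Zarhin)
  set H := hodgeT hN hdisj hxx hxpos with hH
  have hK3 : H.IsOfK3Type := isOfK3Type_hodgeT hN hdisj hxx hxpos
  have hirr : H.IsIrreducible := isIrreducible_hodgeT hN hdisj hxx hxpos
  set ψ : H.Polarization := polT hN hdisj hxx hxpos hu with hψ
  obtain ⟨hFld, ε, hεinj, hε⟩ := Zarhin1983_endAlg_isField_holds H hirr hK3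
  have hω : omega x hdisj ∈ H.piece 2 0 := (mem_piece_two_zero_ofPeriod _ _).2 ⟨1, one_smul _ _⟩
  -- `dim_ℚ T = 22 − ρ(S)`
  have hdimN : Module.finrank ℚ ↥NQ = Module.finrank ℂ ↥N := finrank_ratPoints_eq hS η hηint NQ memNQ
  have hdimΛ : Module.finrank ℚ (K3Index → ℚ) = 22 := by
    rw [Module.finrank_fintype_fun_eq_card]
    simp [Fintype.card_sum, Fintype.card_fin]
  have hdimT : Module.finrank ℚ ↥(k3FormRat.orthogonal NQ) + Module.finrank ℂ ↥N = 22 := by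
    have h := Submodule.finrank_add_eq_of_isCompl hc
    omega
  -- `E` is totally real (else CM)
  have hreal : ∀ (φ' : H.endAlg →+* ℂ) (a : H.endAlg), starRingEnd ℂ (φ' a) = φ' a := by
    by_contra hnot
    push Not at hnot
    obtain ⟨φ', a, hφ'a⟩ := hnot
    exact hCM (hasComplexMultiplication_of_conj_ne hS η p₀ hp₀ hηint hηcup x hx20 hxne hN hdisj hxx hxpos hu a φ' hφ'a)
  -- reading a rational type-preserving endomorphism of `H²(S)` in `E`
  have read : ∀ (G : complexBetti S (2 * 1) →ₗ[ℂ] complexBetti S (2 * 1)),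
      (∀ y, IsRationalClass y → IsRationalClass (G y)) →
      (∀ (i j : ℕ) y, IsOfHodgeType 2 S (2 * 1) i j y → IsOfHodgeType 2 S (2 * 1) i j (G y)) →
      ∃ (φ : Module.End ℚ (K3Index → ℚ)) (hφT : ∀ t ∈ k3FormRat.orthogonal NQ,
          φ t ∈ k3FormRat.orthogonal NQ),
        cxEnd φ = η.toLinearMap ∘ₗ G ∘ₗ η.symm.toLinearMap ∧ φ.restrict hφT ∈ H.endAlg := by
    intro G hG_rat hG_typ
    obtain ⟨φ, hφM, hφx, hφ11⟩ := anchorExistence_cmFloor_exists_ratEnd hHT hS η p₀ hp₀ hηint hηcup x hx20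
      hx20' hxne G hG_rat hG_typ
    have hφT : ∀ t ∈ k3FormRat.orthogonal NQ, φ t ∈ k3FormRat.orthogonal NQ :=
      fun t ht => map_mem_T hN φ hφx ht
    exact ⟨φ, hφT, hφM, restrict_mem_endAlg hN hdisj hxx hxpos φ hφT hφx hφ11⟩
  -- transcendental classes lie in `T_ℂ = ι(ℂ ⊗ T_ℚ)`
  have htr : ∀ y : complexBetti S (2 * 1), Transc[S, y] → iota _ (lam hc (η y)) = η y := by
    intro y hy
    have hzN : ∀ n ∈ NQ, k3Form (η y) (fun i => (n i : ℂ)) = 0 := by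
      intro n hn
      have h := hy _ ((memNQ n).1 hn)
      rw [hηcup, LinearEquiv.apply_symm_apply] at h
      exact hsmul0 h
    exact iota_lam_of_proj_eq_zero hc (cxEnd_projection_eq_zero hdisj hzN)
  -- ### `E ≠ ℚ` (else scalar)
  have hnotbot : ∃ r : H.endAlg, r ∉ (⊥ : Subalgebra ℚ H.endAlg) := by
    by_contra hall
    push Not at hall; apply hQ
    intro f hf_rat hf_typ _ _
    obtain ⟨φ, hφT, hφM, hφE⟩ := read f hf_rat hf_typ
    have hφMapp : ∀ v, cxEnd φ v = η (f (η.symm v)) := fun v => by rw [hφM]; rfl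
    obtain ⟨a, ha⟩ := Algebra.mem_bot.1 (hall ⟨φ.restrict hφT, hφE⟩)
    have ha' : algebraMap ℚ (Module.End ℚ ↥(k3FormRat.orthogonal NQ)) a = φ.restrict hφT := by
      have h := congrArg Subtype.val ha; rwa [Subalgebra.coe_algebraMap] at h
    refine ⟨a, fun y hy => ?_⟩
    have hz := htr y hy
    have hφz : cxEnd φ (η y) = (a : ℂ) • η y := by
      conv_lhs => rw [← hz]
      rw [← iota_baseChange_restrict φ hφT, ← ha', Algebra.algebraMap_eq_smul_one, LinearMap.baseChange_smul,
        LinearMap.smul_apply, Module.End.one_eq_id, LinearMap.baseChange_id, LinearMap.id_apply,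
        ← AnchorExistenceCMFloor.ratCast_smul_eq, map_smul, hz]
    have hfy : f y = η.symm (cxEnd φ (η y)) := by rw [hφMapp, LinearEquiv.symm_apply_apply, LinearEquiv.symm_apply_apply]
    rw [hfy, hφz, map_smul, LinearEquiv.symm_apply_apply]
  obtain ⟨r, hr⟩ := hnotbot
  -- ### the primitive element `r₀` of `E`, with its degree data (van Geemen)
  obtain ⟨r₀, d, hd, hd2, ⟨n, hn, hdimn⟩, hgenE⟩ := exists_generator_endAlg hirr hK3 ψ hFld hreal ε hεinj hr
  -- ### the generator `û := r₀ ⊕ 0_N` on `Λ_ℚ`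
  set û : Module.End ℚ (K3Index → ℚ) :=
    extendT hdisj (r₀ : Module.End ℚ ↥(k3FormRat.orthogonal NQ)) - NQ.projection _ hc with hû
  have hûT : ∀ t' : ↥(k3FormRat.orthogonal NQ), û (t' : K3Index → ℚ) =
      (((r₀ : Module.End ℚ ↥(k3FormRat.orthogonal NQ)) t' : ↥(k3FormRat.orthogonal NQ)) : K3Index → ℚ) := by
    intro t'
    rw [hû, LinearMap.sub_apply, extendT_apply_coe, Submodule.projection_apply_right, sub_zero]
  have hû_memT : ∀ v, û v ∈ k3FormRat.orthogonal NQ := by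
    intro v
    rw [hû, LinearMap.sub_apply, extendT_apply, add_sub_cancel_right]
    exact Submodule.coe_mem _
  have hû_N : ∀ w ∈ NQ, û w = 0 := by
    intro w hw
    rw [hû, LinearMap.sub_apply, extendT_apply_of_mem hdisj _ hw, Submodule.projection_apply_of_mem_left hc hw,
      sub_self]
  have hûpow : ∀ (k : ℕ) (t' : ↥(k3FormRat.orthogonal NQ)),
      ((((r₀ : Module.End ℚ ↥(k3FormRat.orthogonal NQ)) ^ k) t' : ↥(k3FormRat.orthogonal NQ)) :
        K3Index → ℚ) = (û ^ k) (t' : K3Index → ℚ) := by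
    intro k
    induction k with
    | zero => intro t'; rw [pow_zero, pow_zero, Module.End.one_apply, Module.End.one_apply]
    | succ k ih => intro t'; rw [pow_succ', pow_succ', Module.End.mul_apply, Module.End.mul_apply, ← ih, hûT]
  have hcxpow : ∀ i : ℕ, cxEnd (û ^ i) = cxEnd û ^ i := fun i => map_pow cxEndHom û i
  have hûι : ∀ w : ℂ ⊗[ℚ] ↥(k3FormRat.orthogonal NQ), cxEnd û (iota _ w) =
      iota _ ((r₀ : Module.End ℚ ↥(k3FormRat.orthogonal NQ)).baseChange ℂ w) := by
    intro w
    rw [hû, cxEnd_sub, LinearMap.sub_apply, ← iota_baseChange hdisj, cxEnd_projection_iota hc, sub_zero]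
  have hûx : cxEnd û x = ε r₀ • x := by
    have h := hε r₀ (omega x hdisj) hω
    have h2 := congrArg (iota (k3FormRat.orthogonal NQ)) h
    rw [map_smul, iota_omega hN hdisj] at h2
    conv_lhs => rw [← iota_omega hN hdisj, hûι]
    exact h2
  have hû11 : ∀ z : K3Index → ℂ, k3Form z x = 0 → k3Form z (star x) = 0 →
      k3Form (cxEnd û z) x = 0 ∧ k3Form (cxEnd û z) (star x) = 0 := by
    intro z hzx hzx'
    obtain ⟨h1, h2⟩ := k3Form_cxEnd_extendT hN hdisj hxx hxpos r₀.2 hzx hzx'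
    obtain ⟨h3, h4⟩ := k3Form_cxEnd_projection hN hdisj z
    rw [hû, cxEnd_sub, LinearMap.sub_apply, k3Form_sub_left, k3Form_sub_left, h1, h2, h3, h4, sub_zero]
    exact ⟨rfl, rfl⟩
  -- `û_ℂ` kills `η(N¹)` and has image cup-orthogonal to `η(N¹)`
  have hûN_C : ∀ d ∈ N, cxEnd û (η d) = 0 := by
    intro d hd
    have hd' : d ∈ Submodule.span ℂ {c : complexBetti S (2 * 1) |
        IsRationalClass c ∧ c ∈ supportedClasses S (2 * 1) 1} := by rw [← hspan]; exact hd
    clear hd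
    induction hd' using Submodule.span_induction with
    | mem d hd =>
      obtain ⟨w, hw⟩ := (hrat d).1 hd.1
      have hwN : w ∈ NQ := by rw [memNQ, ← hw, LinearEquiv.symm_apply_apply]; exact hd.2
      rw [hw, cxEnd_ratCast, hû_N w hwN]
      exact ratCastΛ_zero
    | zero => rw [map_zero, map_zero]
    | add c c' _ _ hc hc' => rw [map_add, map_add, hc, hc', add_zero]
    | smul a c _ hc => rw [map_smul, map_smul, hc, smul_zero]
  have hûT_C : ∀ (z : K3Index → ℂ), ∀ d ∈ N, k3Form (cxEnd û z) (η d) = 0 := by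
    intro z d hd
    refine Submodule.span_induction (p := fun w _ => k3Form w (η d) = 0) ?_ ?_ ?_ ?_ (cxEnd_mem_span û z)
    · rintro w ⟨v, rfl⟩
      exact horth (û v) (hû_memT v) d hd
    · exact k3Form_zero_left _
    · intro a b _ _ ha hb; rw [k3Form_add_left, ha, hb, add_zero]
    · intro c a _ ha; rw [k3Form_smul_left, ha, mul_zero]
  -- ### the endomorphism `t := η⁻¹ ∘ û_ℂ ∘ η` of `H²(S(ℂ); ℂ)`
  let t : complexBetti S (2 * 1) →ₗ[ℂ] complexBetti S (2 * 1) :=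
    η.symm.toLinearMap ∘ₗ cxEnd û ∘ₗ η.toLinearMap
  have htapp : ∀ y, t y = η.symm (cxEnd û (η y)) := fun y => rfl
  have ht_rat : ∀ y, IsRationalClass y → IsRationalClass (t y) := by
    intro y hy
    obtain ⟨w, hw⟩ := (hrat y).1 hy
    rw [htapp, hw, cxEnd_ratCast]
    exact (hrat _).2 ⟨û w, LinearEquiv.apply_symm_apply _ _⟩
  have htσ : t σ = ε r₀ • σ := by rw [htapp, hησ, hûx, map_smul]
  have ht_typ : ∀ (i j : ℕ) y, IsOfHodgeType 2 S (2 * 1) i j y → IsOfHodgeType 2 S (2 * 1) i j (t y) := by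
    refine typePreserving_of_lines hHT hS hx20 hxne t ⟨ε r₀, htσ⟩ ⟨star (ε r₀), ?_⟩ fun v hv => ?_
    · rw [hσbar, htapp, LinearEquiv.apply_symm_apply, cxEnd_star, hûx, star_smul, map_smul]
    · have hv' := hv
      rw [← LinearEquiv.symm_apply_apply η v, h11_iff] at hv'
      rw [htapp, h11_iff]
      exact hû11 (η v) hv'.1 hv'.2
  have ht_N : ∀ d ∈ N, t d = 0 := fun d hd => by rw [htapp, hûN_C d hd, map_zero]
  have ht_perp : ∀ y : complexBetti S (2 * 1), Transc[S, t y] := by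
    intro y d hd
    rw [hηcup, htapp, LinearEquiv.apply_symm_apply, hûT_C _ d hd, zero_smul]
  have htpow : ∀ (k : ℕ) (y : complexBetti S (2 * 1)), (t ^ k) y = η.symm ((cxEnd û ^ k) (η y)) := by
    intro k
    induction k with
    | zero => intro y; rw [pow_zero, pow_zero, Module.End.one_apply, Module.End.one_apply, LinearEquiv.symm_apply_apply]
    | succ k ih =>
      intro y; rw [pow_succ', pow_succ', Module.End.mul_apply, Module.End.mul_apply, ih, htapp, LinearEquiv.apply_symm_apply]
  -- a rational combination of powers of `û` on `T_ℚ`, complexified on `ι(ℂ ⊗ T_ℚ)`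
  have hcx : ∀ {ι : Type} (s : Finset ι) (c : ι → ℚ) (e : ι → ℕ) (w : ℂ ⊗[ℚ] ↥(k3FormRat.orthogonal NQ)),
      (∑ i ∈ s, ((c i : ℚ) : ℂ) • cxEnd (û ^ e i) (iota _ w)) =
        iota _ ((∑ i ∈ s, c i • (r₀ : Module.End ℚ ↥(k3FormRat.orthogonal NQ)) ^ e i).baseChange ℂ w) := by
    intro ι s c e w
    induction w using TensorProduct.induction_on with
    | zero => simp only [map_zero, smul_zero, Finset.sum_const_zero]
    | tmul a t' =>
      rw [LinearMap.baseChange_tmul, iota_tmul, iota_tmul, LinearMap.sum_apply, Submodule.coe_sum, ratCastΛ_sum,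
        Finset.smul_sum]
      refine Finset.sum_congr rfl fun i _ => ?_
      rw [LinearMap.smul_apply, Submodule.coe_smul, ratCastΛ_smul, hûpow, ← cxEnd_ratCast, map_smul, smul_comm]
    | add w₁ w₂ h₁ h₂ =>
      rw [map_add, map_add, map_add, ← h₁, ← h₂, ← Finset.sum_add_distrib]
      refine Finset.sum_congr rfl fun i _ => ?_
      rw [map_add, smul_add]
  -- ### the data: `P := minpoly_ℚ(r₀)`, `m := dim_E T`
  obtain ⟨hPirr, hPr⟩ := irreducible_minpoly_and_sum_coeff_smul_pow_eq_zero hFld ε hεinj r₀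
  set P := minpoly ℚ (ε r₀) with hPdef
  refine ⟨P, n, hPirr, by omega, hn, ?_, hS, rfl, hCM, t, ht_rat, ht_typ, ht_N, ht_perp, ?_, ?_⟩
  · -- `deg P · m + ρ(S) = 22`
    rw [hd, ← hdimn]; exact hdimT
  · -- `P(t) = 0` on `T(S)`
    intro y hy
    have hz := htr y hy
    have key : η (Polynomial.aeval t (P.map (algebraMap ℚ ℂ)) y) = 0 := by
      have hdeg : (P.map (algebraMap ℚ ℂ)).natDegree < P.natDegree + 1 :=
        lt_of_le_of_lt Polynomial.natDegree_map_le (Nat.lt_succ_self _)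
      rw [Polynomial.aeval_eq_sum_range' hdeg, LinearMap.sum_apply, map_sum]
      calc ∑ i ∈ Finset.range (P.natDegree + 1), η (((P.map (algebraMap ℚ ℂ)).coeff i • t ^ i) y)
          = ∑ i ∈ Finset.range (P.natDegree + 1), ((P.coeff i : ℚ) : ℂ) • cxEnd (û ^ i) (η y) := by
            refine Finset.sum_congr rfl fun i _ => ?_
            rw [Polynomial.coeff_map, LinearMap.smul_apply, map_smul, eq_ratCast, htpow,
              LinearEquiv.apply_symm_apply, ← hcxpow]
        _ = 0 := by
            rw [← hz, hcx, hPr, LinearMap.baseChange_zero, LinearMap.zero_apply, map_zero]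
    exact η.injective (by rw [key, map_zero])
  · -- generation: `End_Hdg(T(S)) = ℚ[t|_T]`
    intro f hf_rat hf_typ _ _
    obtain ⟨φf, hφfT, hφfM, hrf⟩ := read f hf_rat hf_typ
    have hφfMapp : ∀ v, cxEnd φf v = η (f (η.symm v)) := fun v => by rw [hφfM]; rfl
    obtain ⟨c, hc'⟩ := hgenE ⟨φf.restrict hφfT, hrf⟩
    refine ⟨d, c, fun y hy => ?_⟩
    have hz := htr y hy
    have hval : ((⟨φf.restrict hφfT, hrf⟩ : H.endAlg) : Module.End ℚ ↥(k3FormRat.orthogonal NQ)) =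
        φf.restrict hφfT := rfl
    have hfy : f y = η.symm (cxEnd φf (η y)) := by rw [hφfMapp, LinearEquiv.symm_apply_apply, LinearEquiv.symm_apply_apply]
    have h1 : cxEnd φf (η y) = ∑ i : Fin d, ((c i : ℚ) : ℂ) • cxEnd (û ^ (i : ℕ)) (η y) := by
      rw [← hz, hcx, ← hc', hval, iota_baseChange_restrict φf hφfT]
    rw [hfy, h1, map_sum]
    refine Finset.sum_congr rfl fun i _ => ?_
    rw [map_smul, htpow, hcxpow]

end Summit.HodgeConjecture.HodgeConjecture.Theorems.MarkmanPartnerTransport.RealMultiplicationType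

end
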